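import Mathlib.CategoryTheory.Whiskering
import Literature.AlgebraicGeometry.Frobenioids.Prop53Sub
import HarnessLib

/-!
# Frobenioids I, Corollary 5.4: the 1-commutative square `ι₁ ⋙ Ψ^rlf ≅ Ψ|_{istr} ⋙ ι₂` (row C54/L06) — the
# pasting closer over its three constituent squares (PROOF)

Mochizuki, *The geometry of Frobenioids I: the general theory*, Kyushu J. Math. **62** (2008) 293–400,
Corollary 5.4, kurims p. 104 ll. 1–6 (the 1-commutative diagram with vertical arrows "the natural functors of
Proposition 5.3") and proof ll. 21–22 ("In light of the definition of the realification [cf. Proposition 5.3],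
Corollary 5.4 follows immediately from Corollaries 4.10; 4.11, (iii), (iv)"); Proposition 5.3, p. 103 ll. 20–30
(the 1-commutative diagram `C^istr → C^un-tr → C^rlf` and "`C^un-tr` … may be obtained as the model Frobenioid
associated to `Φ` and `Φ^birat`"). [cite: MochizukiFrdI2008, Cor. 5.4 p.104] [cite: MochizukiFrdI2008, Prop. 5.3 p.103]

THE vertical arrow of the printed diagram is `ι_i = toUntr_i ⋙ e_i ⋙ untrToRlf_i : C_i^istr → C_i^un-tr ≌
(model of (Φ_i, Φ_i^birat)) → C_i^rlf` (`FrdI.Prop53Sub.iotaRlf`, seat abc-iut-w5-d137, over the comparison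
equivalence `e_i` of Prop. 5.3 — in tree: abc-iut-L1-d5's `PreFrobenioid.exists_untr_comparison`).  Accordingly
the square of Cor. 5.4 (slot `FrdI.Cor54Sub.Square`, `Prop53Sub.lean`) is the PASTING of three squares, one per
factor — exactly print's "follows immediately from Corollaries 4.10; 4.11, (iii), (iv)" read on the diagram of
Prop. 5.3:

* (a) the unit-trivialization square `toUntr₁ ⋙ Ψ^un-tr ≅ Ψ|_{istr} ⋙ toUntr₂` (Cor. 4.11 (i));
* (b) the comparison square `e₁ ⋙ Ψ^M ≅ Ψ^un-tr ⋙ e₂` — `Ψ^un-tr`, read in the model descriptions of the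
  `C_i^un-tr`, is the functor `Ψ^M` induced by the data `(Ψ^Base, Ψ^Φ)` (Cor. 4.11 (iii), (iv) for `C^un-tr`);
* (c) the realification-row square `untrToRlf₁ ⋙ Ψ^rlf ≅ Ψ^M ⋙ untrToRlf₂` (both composites are induced by the
  data `(Ψ^Base, (Ψ^Φ)^rlf ∘ ι₁ = ι₂ ∘ Ψ^Φ)`; Cor. 4.10 / "the definition of the realification").

This file (cell abc-iut, L1 sub-DAG W3 row **C54/L06**, seat abc-iut-w5-d048 per L1-lead R98 (5)) proves the
closer `FrdI.Cor54Sub.square_of (ha) (hb) (hc) : Square …` over those three squares as NAMED BINDERS (free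
functors `Ψuntr`, `ΨM`; the provers of (a)/(b)/(c) instantiate it), and the variant `square_of_model` with (a), (b)
already pasted.  Proof-only (no `def`); nothing here bears on [IUTchIII] or asserts anything about abc.
-/

noncomputable section

namespace Literature.AlgebraicGeometry.Frobenioids

open CategoryTheory

universe w v₁ v₁' u₁ u₁' v₂ v₂' u₂ u₂'

namespace FrdI.Cor54Sub

variable {D₁ : Type u₁'} [Category.{v₁'} D₁] {Φ₁ : D₁ᵒᵖ ⥤ CommMonCat.{w}}
  {C₁ : Type u₁} [Category.{v₁} C₁] {F₁ : C₁ ⥤ ElemFrobenioid Φ₁} (hΦ₁ : PreFrobenioid.IsPerfFactorialOn Φ₁)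
  {D₂ : Type u₂'} [Category.{v₂'} D₂] {Φ₂ : D₂ᵒᵖ ⥤ CommMonCat.{w}}
  {C₂ : Type u₂} [Category.{v₂} C₂] {F₂ : C₂ ⥤ ElemFrobenioid Φ₂} (hΦ₂ : PreFrobenioid.IsPerfFactorialOn Φ₂)
  (Ψistr : (PreFrobenioidData.ofFunctor Φ₁ F₁).Istr ⥤ (PreFrobenioidData.ofFunctor Φ₂ F₂).Istr)
  (e₁ : (PreFrobenioidData.ofFunctor Φ₁ F₁).Untr ≌ PreFrobenioid.untrModel F₁)
  (e₂ : (PreFrobenioidData.ofFunctor Φ₂ F₂).Untr ≌ PreFrobenioid.untrModel F₂)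
  (Ψrlf : PreFrobenioid.rlf F₁ hΦ₁ ⥤ PreFrobenioid.rlf F₂ hΦ₂)
  (Ψuntr : (PreFrobenioidData.ofFunctor Φ₁ F₁).Untr ⥤ (PreFrobenioidData.ofFunctor Φ₂ F₂).Untr)
  (ΨM : PreFrobenioid.untrModel F₁ ⥤ PreFrobenioid.untrModel F₂)

/-- **C54/L06, the closer over its three constituent squares**: (a) the unit-trivialization square of
Cor. 4.11 (i), (b) the comparison square (Cor. 4.11 (iii)/(iv) for `C^un-tr` through the Prop. 5.3 equivalences
`e_i`), (c) the realification-row square ⟹ the square of Cor. 5.4 (`FrdI.Cor54Sub.Square`).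
[cite: MochizukiFrdI2008, Cor. 5.4 p.104] -/
theorem square_of
    (ha : Nonempty ((PreFrobenioidData.ofFunctor Φ₁ F₁).toUntr ⋙ Ψuntr ≅
      Ψistr ⋙ (PreFrobenioidData.ofFunctor Φ₂ F₂).toUntr))
    (hb : Nonempty (e₁.functor ⋙ ΨM ≅ Ψuntr ⋙ e₂.functor))
    (hc : Nonempty (PreFrobenioid.untrToRlf F₁ hΦ₁ ⋙ Ψrlf ≅ ΨM ⋙ PreFrobenioid.untrToRlf F₂ hΦ₂)) :
    Square hΦ₁ hΦ₂ Ψistr e₁ e₂ Ψrlf := by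
  obtain ⟨ia⟩ := ha
  obtain ⟨ib⟩ := hb
  obtain ⟨ic⟩ := hc
  refine ⟨?_⟩
  calc FrdI.Prop53Sub.iotaRlf F₁ hΦ₁ e₁ ⋙ Ψrlf
    _ ≅ (PreFrobenioidData.ofFunctor Φ₁ F₁).toUntr ⋙ e₁.functor ⋙ (PreFrobenioid.untrToRlf F₁ hΦ₁ ⋙ Ψrlf) :=
        Functor.associator _ _ _ ≪≫ Functor.isoWhiskerLeft _ (Functor.associator _ _ _)
    _ ≅ (PreFrobenioidData.ofFunctor Φ₁ F₁).toUntr ⋙ e₁.functor ⋙ (ΨM ⋙ PreFrobenioid.untrToRlf F₂ hΦ₂) :=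
        Functor.isoWhiskerLeft _ (Functor.isoWhiskerLeft _ ic)
    _ ≅ (PreFrobenioidData.ofFunctor Φ₁ F₁).toUntr ⋙ (e₁.functor ⋙ ΨM) ⋙ PreFrobenioid.untrToRlf F₂ hΦ₂ :=
        Functor.isoWhiskerLeft _ ((Functor.associator _ _ _).symm)
    _ ≅ (PreFrobenioidData.ofFunctor Φ₁ F₁).toUntr ⋙ (Ψuntr ⋙ e₂.functor) ⋙ PreFrobenioid.untrToRlf F₂ hΦ₂ :=
        Functor.isoWhiskerLeft _ (Functor.isoWhiskerRight ib _)
    _ ≅ ((PreFrobenioidData.ofFunctor Φ₁ F₁).toUntr ⋙ Ψuntr) ⋙ e₂.functor ⋙ PreFrobenioid.untrToRlf F₂ hΦ₂ :=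
        Functor.isoWhiskerLeft _ (Functor.associator _ _ _) ≪≫ (Functor.associator _ _ _).symm
    _ ≅ (Ψistr ⋙ (PreFrobenioidData.ofFunctor Φ₂ F₂).toUntr) ⋙ e₂.functor ⋙ PreFrobenioid.untrToRlf F₂ hΦ₂ :=
        Functor.isoWhiskerRight ia _
    _ ≅ Ψistr ⋙ FrdI.Prop53Sub.iotaRlf F₂ hΦ₂ e₂ := Functor.associator _ _ _


/-- The same with (a) and (b) already pasted into the single square `toUntr₁ ⋙ e₁ ⋙ Ψ^M ≅ Ψ^istr ⋙ toUntr₂ ⋙ e₂`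
(the shape produced when `Ψ^un-tr` is only given through the model descriptions). [cite: MochizukiFrdI2008, Cor. 5.4 p.104] -/
theorem square_of_model
    (hab : Nonempty ((PreFrobenioidData.ofFunctor Φ₁ F₁).toUntr ⋙ e₁.functor ⋙ ΨM ≅
      Ψistr ⋙ (PreFrobenioidData.ofFunctor Φ₂ F₂).toUntr ⋙ e₂.functor))
    (hc : Nonempty (PreFrobenioid.untrToRlf F₁ hΦ₁ ⋙ Ψrlf ≅ ΨM ⋙ PreFrobenioid.untrToRlf F₂ hΦ₂)) :
    Square hΦ₁ hΦ₂ Ψistr e₁ e₂ Ψrlf := by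
  obtain ⟨iab⟩ := hab
  obtain ⟨ic⟩ := hc
  refine ⟨?_⟩
  calc FrdI.Prop53Sub.iotaRlf F₁ hΦ₁ e₁ ⋙ Ψrlf
    _ ≅ (PreFrobenioidData.ofFunctor Φ₁ F₁).toUntr ⋙ e₁.functor ⋙ (PreFrobenioid.untrToRlf F₁ hΦ₁ ⋙ Ψrlf) :=
        Functor.associator _ _ _ ≪≫ Functor.isoWhiskerLeft _ (Functor.associator _ _ _)
    _ ≅ (PreFrobenioidData.ofFunctor Φ₁ F₁).toUntr ⋙ e₁.functor ⋙ (ΨM ⋙ PreFrobenioid.untrToRlf F₂ hΦ₂) :=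
        Functor.isoWhiskerLeft _ (Functor.isoWhiskerLeft _ ic)
    _ ≅ ((PreFrobenioidData.ofFunctor Φ₁ F₁).toUntr ⋙ e₁.functor ⋙ ΨM) ⋙ PreFrobenioid.untrToRlf F₂ hΦ₂ :=
        Functor.isoWhiskerLeft _ ((Functor.associator _ _ _).symm) ≪≫ (Functor.associator _ _ _).symm
    _ ≅ (Ψistr ⋙ (PreFrobenioidData.ofFunctor Φ₂ F₂).toUntr ⋙ e₂.functor) ⋙ PreFrobenioid.untrToRlf F₂ hΦ₂ :=
        Functor.isoWhiskerRight iab _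
    _ ≅ Ψistr ⋙ FrdI.Prop53Sub.iotaRlf F₂ hΦ₂ e₂ :=
        Functor.associator _ _ _ ≪≫ Functor.isoWhiskerLeft _ (Functor.associator _ _ _)

end FrdI.Cor54Sub

end Literature.AlgebraicGeometry.Frobenioids

end
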